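import Literature.Analysis.FluidPDE.FluidComputer.TubeTable
import HarnessLib

/-!
# Kernel run of the tube checker, chunks 42 … 47 (steps 2100 … 2352) (bp3 gen 13)

HONEST FRAMING: low prior, high value-of-information experiment on Tao's machine paradigm; NOT a
claim that NS blows up.

Kernel evaluations (`decide +kernel`; no `native_decide`, no extra axioms) of the tube checker
`runTube` of `TubeCheck.lean` (dyadic interval arithmetic `DI` at `P = 60`, `12` Taylor terms,
cube radius `Rt`, read-out level `CLt`) on the chunks `cT 42 … cT 47` of the schedule of
`TubeTable.lean`, each from the recorded boundary state `sT i` to `sT (i+1)` (≈ 0.6 s of kernel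
time per step).
-/

namespace Literature.Analysis.FluidPDE.FluidComputer

namespace TubeTable

open ThresholdLevelTable

set_option maxHeartbeats 10000000 in
set_option maxRecDepth 200000 in
/-- Chunk 42 of the tube run (steps 2100 … 2149, `h = 2^-11`). [folklore] -/
theorem run_42 : runTube 60 12 GIt CLt Rt (sT 42) (cT 42) = some (sT (42 + 1)) := by
  decide +kernel

set_option maxHeartbeats 10000000 in
set_option maxRecDepth 200000 in
/-- Chunk 43 of the tube run (steps 2150 … 2169, `h = 2^-11`). [folklore] -/
theorem run_43 : runTube 60 12 GIt CLt Rt (sT 43) (cT 43) = some (sT (43 + 1)) := by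
  decide +kernel

set_option maxHeartbeats 10000000 in
set_option maxRecDepth 200000 in
/-- Chunk 44 of the tube run (steps 2170 … 2219, `h = 2^-13`). [folklore] -/
theorem run_44 : runTube 60 12 GIt CLt Rt (sT 44) (cT 44) = some (sT (44 + 1)) := by
  decide +kernel

set_option maxHeartbeats 10000000 in
set_option maxRecDepth 200000 in
/-- Chunk 45 of the tube run (steps 2220 … 2269, `h = 2^-13`). [folklore] -/
theorem run_45 : runTube 60 12 GIt CLt Rt (sT 45) (cT 45) = some (sT (45 + 1)) := by
  decide +kernel

set_option maxHeartbeats 10000000 in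
set_option maxRecDepth 200000 in
/-- Chunk 46 of the tube run (steps 2270 … 2319, `h = 2^-13`). [folklore] -/
theorem run_46 : runTube 60 12 GIt CLt Rt (sT 46) (cT 46) = some (sT (46 + 1)) := by
  decide +kernel

set_option maxHeartbeats 10000000 in
set_option maxRecDepth 200000 in
/-- Chunk 47 of the tube run (steps 2320 … 2352, `h = 2^-13`). [folklore] -/
theorem run_47 : runTube 60 12 GIt CLt Rt (sT 47) (cT 47) = some (sT (47 + 1)) := by
  decide +kernel

end TubeTable

end Literature.Analysis.FluidPDE.FluidComputer
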